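import Literature.AnabelianGeometry.SemiGraphs.GaloisCoveringTorsor
import HarnessLib

/-!
# Branch stabilisers of a Galois covering are CYCLIC images of the branch group: cardinalities and orders
# ([SemiAnbd] Rmk 2.2.1 at one level; dictionary for the exotic maximal compacts of `π₁^temp(𝒢_θ)`)

Mochizuki, *Semi-graphs of anabelioids*, Publ. RIMS **42** (2006), §2 Rmk. 2.2.1 p. 24 (decomposition groups
of vertices / edges of a covering as images of `Π_v`, `Π_e`) and §3 Thm 3.7 (iii)/(iv) pp. 40–41
[cite: MochizukiSemiAnbd2006, Rmk. 2.2.1 p.24].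

PROOF-ONLY file (abc-iut cell, layer L3, seat abc-iut-L3-d4 gen 4, brick «EXOTIC-IS-C» of the typed-form sweep
at `𝒢_θ` — the structure of ANCHOR-FREE maximal compact subgroups; 0 definitions, no named fact).  For a connected
covering `S` with point-transitive automorphisms (the hypotheses `hconn`/`htrans` of abc-iut-L3-d3's
`GaloisCoveringTorsor.lean`, e.g. the universal tempered coverings `𝒢_{∞,n}`), abc-iut-L3-d3's dictionary
`CovObj.stab_brOf_iff` says that the stabiliser in `Aut S` of the branch `brOf b (σ·x)` is `σ ψ_x(Π_b) σ⁻¹`.  Here: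

* `CovObj.le_map_ptHom_branchSubgroup_of_forall_fix_brOf` — a subgroup of `Aut S` fixing the branch `brOf b y`
  lies in `ψ_y(Π_b)`;
* `CovObj.map_ptHom_branchSubgroup_eq_zpowers` — if the edge group `Π_e` is topologically generated by one
  element `e₀` (e.g. `Π_e ≅ ℤ_p`), then `ψ_y(Π_b) = ⟨ψ_y(b_*(e₀))⟩` is CYCLIC (the kernel of `ψ_y ∘ b_*` is open,
  `⟨e₀⟩` is dense), so its cardinality is `orderOf (ψ_y (b_* e₀))`;
* `CovObj.ptHom_pow_eq_one_iff` / `CovObj.ptHom_brHom_pow_eq_one_iff_of_glue` — `ψ_y(h)^d = 1 ↔ h^d` fixes `y`,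
  and, for `y = glue_b yE`, `↔ e₀^d` fixes the EDGE point `yE` — so the order of `ψ_y(b_*(e₀))` depends only on the
  edge point, not on the branch of the edge through which it is read;
* `CovObj.ρ_eq_self_iff_of_htrans` / `CovObj.orderOf_ptHom_eq_of_htrans` — point stabilisers, hence these
  orders, are the same for all points of one vertex fibre (automorphisms are transitive and commute with `Π_v`).

Consumer: `ThetaRayExoticMaximalCompact.lean` (the escaping procyclic compact subgroup of `π₁^temp(𝒢_θ)` is
itself a maximal compact subgroup).  Nothing here bears on [IUTchIII] Cor. 3.12; no side taken; typed ≠ proved.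
-/

namespace Literature.AnabelianGeometry.SemiGraphs

namespace ProfiniteSemiGraph

open CategoryTheory Topology
open Literature.AlgebraicGeometry.Frobenioids.QuasiTemperoid.BTempConnected (ρ_one_apply
  ρ_mul_apply ρ_inv_apply ρ_apply_inv)

universe u

variable {𝒢 : ProfiniteSemiGraph.{u}} (S : CovObj 𝒢)
  (hconn : ∀ p q : S.Point, S.SameComponent p q)
  (htrans : ∀ (v : 𝒢.graph.Vertex) (x x' : (S.SV v).obj.V), ∃ σ : S ⟶ S, (σ.fV v).hom.hom x = x')

variable {b : 𝒢.graph.Branch} {v : 𝒢.graph.Vertex} (hb : 𝒢.graph.abuts b = some v)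

include hconn htrans

/-- **A subgroup of `Aut S` fixing the branch `brOf b y` lies in `ψ_y(Π_b)`** (abc-iut-L3-d3's
`CovObj.stab_brOf_iff` at `σ = 1`). [cite: MochizukiSemiAnbd2006, Rmk. 2.2.1 p.24] -/
theorem CovObj.le_map_ptHom_branchSubgroup_of_forall_fix_brOf (y : (S.SV v).obj.V) (K : Subgroup (Aut S))
    (hK : ∀ q ∈ K, (CovObj.orbitGraphMap q.hom).branchMap (S.brOf b hb y) = S.brOf b hb y) :
    K ≤ (𝒢.branchSubgroup b v hb).map (S.ptHom hconn htrans y) := by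
  intro q hq
  obtain ⟨σ, hσ⟩ := S.exists_aut_fV_eq hconn htrans y y
  have hfix := hK q hq
  rw [← hσ] at hfix
  obtain ⟨a, ha, rfl⟩ := Subgroup.mem_map.mp ((S.stab_brOf_iff hconn htrans y σ q).mp hfix)
  -- `σ` fixes `y`, so `σ = 1` by rigidity, and the conjugate is `a` itself
  have hσ1 : σ = 1 := S.aut_eq_of_fV_eq hconn y (by rw [hσ]; rfl)
  subst hσ1
  simpa using ha

/-- `ψ_y(h)^d = 1` iff `h^d` fixes `y`. [cite: MochizukiSemiAnbd2006, Rmk. 2.2.1 p.24] -/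
theorem CovObj.ptHom_pow_eq_one_iff (y : (S.SV v).obj.V) (h : 𝒢.Gv v) (d : ℕ) :
    S.ptHom hconn htrans y h ^ d = 1 ↔ (S.SV v).obj.ρ (h ^ d) y = y := by
  rw [← map_pow, S.ptHom_eq_one_iff hconn htrans y]

/-- **The order of `ψ_y(b_*(t))` is read on the EDGE point**: for `y = glue_b yE`,
`ψ_y(b_*(t))^d = 1 ↔ t^d · yE = yE` (equivariance of the gluing).  Hence two branches of one edge, read at the
images of one edge point, give elements of the same order. [cite: MochizukiSemiAnbd2006, Rmk. 2.2.1 p.24] -/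
theorem CovObj.ptHom_brHom_pow_eq_one_iff_of_glue (yE : (S.SE (𝒢.graph.edgeOf b)).obj.V)
    (t : 𝒢.Ge (𝒢.graph.edgeOf b)) (d : ℕ) :
    S.ptHom hconn htrans ((S.glue b v hb).hom.hom.hom yE) (𝒢.brHom b v hb t) ^ d = 1 ↔
      (S.SE (𝒢.graph.edgeOf b)).obj.ρ (t ^ d) yE = yE := by
  rw [S.ptHom_pow_eq_one_iff hconn htrans, ← map_pow, ← S.glue_ρ b v hb]
  constructor
  · intro h
    have := congrArg (S.glue b v hb).inv.hom.hom h
    rwa [S.glue_inv_hom, S.glue_inv_hom] at this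
  · intro h
    rw [h]

/-- **Point stabilisers are constant along a vertex fibre** of a covering with transitive automorphisms:
`h · y = y ↔ h · y' = y'`. [cite: MochizukiSemiAnbd2006, Rmk. 2.2.1 p.24] -/
theorem CovObj.ρ_eq_self_iff_of_htrans (y y' : (S.SV v).obj.V) (h : 𝒢.Gv v) :
    (S.SV v).obj.ρ h y = y ↔ (S.SV v).obj.ρ h y' = y' := by
  constructor
  · intro hy
    obtain ⟨σ, hσ⟩ := S.exists_aut_fV_eq hconn htrans y y'
    rw [← hσ, ← CovHom.fV_ρ, hy]
  · intro hy'
    obtain ⟨σ, hσ⟩ := S.exists_aut_fV_eq hconn htrans y' y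
    rw [← hσ, ← CovHom.fV_ρ, hy']

/-- Hence `orderOf (ψ_y h) = orderOf (ψ_{y'} h)` for all points `y`, `y'` of one vertex fibre.
[cite: MochizukiSemiAnbd2006, Rmk. 2.2.1 p.24] -/
theorem CovObj.orderOf_ptHom_eq_of_htrans (y y' : (S.SV v).obj.V) (h : 𝒢.Gv v) :
    orderOf (S.ptHom hconn htrans y h) = orderOf (S.ptHom hconn htrans y' h) := by
  rw [orderOf_eq_orderOf_iff]
  intro d
  rw [S.ptHom_pow_eq_one_iff hconn htrans, S.ptHom_pow_eq_one_iff hconn htrans]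
  exact S.ρ_eq_self_iff_of_htrans hconn htrans y y' (h ^ d)

/-- **`ψ_y(Π_b)` is cyclic, generated by `ψ_y(b_*(e₀))`, when `Π_e` is topologically generated by `e₀`**
(e.g. `Π_e ≅ ℤ_p`, `e₀ = 1`): the kernel of `ψ_y ∘ b_*` is an open subgroup of `Π_e` and `⟨e₀⟩` is dense, so
every value is a value at a power of `e₀`. [cite: MochizukiSemiAnbd2006, Rmk. 2.2.1 p.24] -/
theorem CovObj.map_ptHom_branchSubgroup_eq_zpowers (y : (S.SV v).obj.V) (e₀ : 𝒢.Ge (𝒢.graph.edgeOf b))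
    (hgen : (Subgroup.zpowers e₀).topologicalClosure = ⊤) :
    (𝒢.branchSubgroup b v hb).map (S.ptHom hconn htrans y) =
      Subgroup.zpowers (S.ptHom hconn htrans y (𝒢.brHom b v hb e₀)) := by
  -- the composite `ζ := ψ_y ∘ b_*`
  set ζ : 𝒢.Ge (𝒢.graph.edgeOf b) →* Aut S := (S.ptHom hconn htrans y).comp (𝒢.brHom b v hb).toMonoidHom
    with hζ
  have hrange : (𝒢.branchSubgroup b v hb).map (S.ptHom hconn htrans y) = ζ.range := by
    rw [hζ, ← MonoidHom.map_range]; rfl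
  rw [hrange]
  apply le_antisymm
  · rintro _ ⟨t, rfl⟩
    -- the open coset `t · ker ζ` meets the dense subgroup `⟨e₀⟩`
    have hker : IsOpen ((ζ.ker : Subgroup _) : Set (𝒢.Ge (𝒢.graph.edgeOf b))) := by
      have : ((ζ.ker : Subgroup _) : Set (𝒢.Ge (𝒢.graph.edgeOf b))) =
          (𝒢.brHom b v hb) ⁻¹' (S.ptHom hconn htrans y ⁻¹' {1}) := by
        ext s; simp [hζ, MonoidHom.mem_ker]
      rw [this]
      exact (S.isOpen_ptHom_preimage hconn htrans y 1).preimage (𝒢.brHom b v hb).continuous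
    have hopen : IsOpen ((fun u => t * u) '' ((ζ.ker : Subgroup _) : Set (𝒢.Ge (𝒢.graph.edgeOf b)))) :=
      (isOpenMap_mul_left t) _ hker
    have hne : ((fun u => t * u) '' ((ζ.ker : Subgroup _) : Set (𝒢.Ge (𝒢.graph.edgeOf b)))).Nonempty :=
      ⟨t * 1, 1, ζ.ker.one_mem, rfl⟩
    have hdense : Dense ((Subgroup.zpowers e₀ : Subgroup _) : Set (𝒢.Ge (𝒢.graph.edgeOf b))) := by
      rw [dense_iff_closure_eq, ← Subgroup.topologicalClosure_coe, hgen]; rfl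
    obtain ⟨s, hs, u, hu, rfl⟩ := hdense.exists_mem_open hopen hne
    -- `ζ (t * u) = ζ t` and `t * u ∈ ⟨e₀⟩`
    have hζtu : ζ (t * u) = ζ t := by
      rw [map_mul, (MonoidHom.mem_ker).mp hu, mul_one]
    rw [← hζtu]
    have : ζ (t * u) ∈ (Subgroup.zpowers e₀).map ζ := Subgroup.mem_map_of_mem ζ hs
    rwa [MonoidHom.map_zpowers] at this
  · rw [Subgroup.zpowers_le]
    exact ⟨e₀, rfl⟩

/-- Hence `|ψ_y(Π_b)| = orderOf (ψ_y (b_* e₀))`. [cite: MochizukiSemiAnbd2006, Rmk. 2.2.1 p.24] -/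
theorem CovObj.card_map_ptHom_branchSubgroup (y : (S.SV v).obj.V) (e₀ : 𝒢.Ge (𝒢.graph.edgeOf b))
    (hgen : (Subgroup.zpowers e₀).topologicalClosure = ⊤) :
    Nat.card ((𝒢.branchSubgroup b v hb).map (S.ptHom hconn htrans y)) =
      orderOf (S.ptHom hconn htrans y (𝒢.brHom b v hb e₀)) := by
  rw [S.map_ptHom_branchSubgroup_eq_zpowers hconn htrans hb y e₀ hgen, Nat.card_zpowers]

/-- **The squeeze**: a subgroup `K` of `Aut S` fixing the branch `brOf b y`, with `Π_e` topologically generated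
by `e₀`, lies in the cyclic group `⟨ψ_y(b_* e₀)⟩`; if moreover `K` contains an element `γ` of finite order EQUAL to
`orderOf (ψ_y (b_* e₀))`, then `K = ⟨γ⟩`. [cite: MochizukiSemiAnbd2006, Rmk. 2.2.1 p.24] -/
theorem CovObj.eq_zpowers_of_forall_fix_brOf_of_orderOf_eq (y : (S.SV v).obj.V) (e₀ : 𝒢.Ge (𝒢.graph.edgeOf b))
    (hgen : (Subgroup.zpowers e₀).topologicalClosure = ⊤) (K : Subgroup (Aut S))
    (hK : ∀ q ∈ K, (CovObj.orbitGraphMap q.hom).branchMap (S.brOf b hb y) = S.brOf b hb y)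
    (γ : Aut S) (hγ : γ ∈ K) (hfin : IsOfFinOrder γ)
    (hord : orderOf (S.ptHom hconn htrans y (𝒢.brHom b v hb e₀)) = orderOf γ) :
    K = Subgroup.zpowers γ := by
  have hKle : K ≤ Subgroup.zpowers (S.ptHom hconn htrans y (𝒢.brHom b v hb e₀)) := by
    rw [← S.map_ptHom_branchSubgroup_eq_zpowers hconn htrans hb y e₀ hgen]
    exact S.le_map_ptHom_branchSubgroup_of_forall_fix_brOf hconn htrans hb y K hK
  have hγle : Subgroup.zpowers γ ≤ K := (Subgroup.zpowers_le).mpr hγ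
  -- `⟨γ⟩ ≤ K ≤ ⟨ψ_y(b_* e₀)⟩` with `|⟨ψ_y(b_* e₀)⟩| = |⟨γ⟩|` finite
  have hfin' : IsOfFinOrder (S.ptHom hconn htrans y (𝒢.brHom b v hb e₀)) := by
    rw [← orderOf_pos_iff, hord]
    exact hfin.orderOf_pos
  haveI : Finite (Subgroup.zpowers (S.ptHom hconn htrans y (𝒢.brHom b v hb e₀))) := hfin'.finite_zpowers
  have heq : Subgroup.zpowers γ = Subgroup.zpowers (S.ptHom hconn htrans y (𝒢.brHom b v hb e₀)) :=
    Subgroup.eq_of_le_of_card_ge (hγle.trans hKle) (by rw [Nat.card_zpowers, Nat.card_zpowers, hord])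
  exact le_antisymm (hKle.trans heq.ge) hγle

end ProfiniteSemiGraph

end Literature.AnabelianGeometry.SemiGraphs
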